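import Summits.ResolutionOfSingularities.ResolutionOfSingularities.Theorems.EquisingularLiftEquisingularLiftNatMemberKCStepRegular
import Summits.ResolutionOfSingularities.ResolutionOfSingularities.Theorems.EquisingularLiftEquisingularLiftNatSingularPointDescends
import HarnessLib

/-!
# [OURS · L1 W4.5(b) · EL♮(3)] HSUB′(ReachTower₁) inner chain — (B)KC: the driver clause (step, flag kept) at `INV := TCPlus.InvKC`
# (res-L1-w45b-stub-4's (B) `inv_step_regular` p543848 with shadow (vii) and Cartier clause (viii) threaded; res-D-pv-029 p554345 currency)
# (crux `EquisingularLiftNatThree` = stmt-ResolutionOfSingularities-20148, parent `EquisingularLiftNat` = stmt-…-20038)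

HONEST FRAMING. OURS (cell res-hironaka, crux chain w45b, slot W4.5(b)); NOT a statement of any manuscript; AI-written, weaker than expert
review. Helper `--supports stmt-ResolutionOfSingularities-20148 --as helper`; closes nothing; no `sorry`; standard axioms; DEF-FREE. Proof = (B)
verbatim with (A)KC (`memberKC_strictTransform_of_regularPoint`) in place of (A).

* `invKC_step_regular` — `TCPlus.InvKC … W G₁ β T Z K_d b` ⟹ `TCPlus.InvKC … W G₂ (υ₁ ≫ β) (closure υ₁⁻¹(T∖{y})) (closure υ₁⁻¹(Z∖{y}))
  (closure υ₁⁻¹(K_d∖{y})) b` = hypothesis (step, flag kept) of `hsub_reachTower_of_invariant` (p549473) / its `₁`/`₂` twins at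
  `INV := TCPlus.InvKC O k θ P q Y Ch` (res-D-pv-029's cone branch `INV := (K_d = ∅ ∧ Inv) ∨ (InvKC ∧ …)`).

References: H. Matsumura (1986), Thm. 14.2; U. Görtz, T. Wedhorn (2020), Prop. 13.91 — through the cited tree files.
-/

set_option linter.dupNamespace false -- mandated namespace `Summit.<Summit>.<Problem>` of this single-conjunct summit
set_option linter.overlappingInstances false -- signatures carry `[IsDomain O] [IsDiscreteValuationRing O]`

noncomputable section

open CategoryTheory CategoryTheory.Limits AlgebraicGeometry TopologicalSpace Topology IsLocalRing
open Literature.AlgebraicGeometry.Resolution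
open AlgebraicGeometry.Scheme.IdealSheafData
open Summit.ResolutionOfSingularities.ResolutionOfSingularities.Theses.EquisingularLift.Split
open Summit.ResolutionOfSingularities.ResolutionOfSingularities.Cruxes.EquisingularLift.StrataSplit
open scoped nonZeroDivisors

namespace Summit.ResolutionOfSingularities.ResolutionOfSingularities.Cruxes.EquisingularLiftNat.Sections

/-- **(B)KC — the driver clause (step, flag kept) at `INV := TCPlus.InvKC`**: (B) `inv_step_regular` (p543848) with the shadow
`K_d ↦ closure υ₁⁻¹(K_d ∖ {y})` and the Cartier clause threaded through both members ((A)KC twice; package transport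
`centredPackage_strictTransform` p541005). [cite: Matsumura1987, Thm. 14.2] [cite: GortzWedhorn2020, Prop. 13.91] [OURS · L1 W4.5b] toward
`stub_elnat_coneTowerPointResolution`; NOT a statement of the manuscript. -/
theorem invKC_step_regular (O : Type) [CommRing O] [IsDomain O] [IsDiscreteValuationRing O]
    [IsAdicComplete (maximalIdeal O) O] [IsAlgClosed (ResidueField O)] (k : Type) [Field k] (θ : O →+* k)
    (hθ : Function.Surjective θ)
    (P : Scheme.{0}) (q : P ⟶ Spec (.of O)) (Y : Set P) (hY : Y ⊆ q ⁻¹' {closedPoint O}) (hYirr : IsIrreducible Y)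
    (hYcl : IsClosed Y) [IsProper q] [IsIntegral P] (hPnoeth : IsLocallyNoetherian P) (hPreg : Scheme.IsRegular P)
    [SmoothOfRelativeDimension 3 q]
    (Ch : ∀ X' : Scheme.{0}, (X' ⟶ P) → Set X' → Prop)
    (hChain : ∀ (X' : Scheme.{0}) (σ : X' ⟶ P) (S : Set X'), Ch X' σ S → Chain P Y X' σ S)
    (hStep : ∀ (X' X'' : Scheme.{0}) (σ' : X' ⟶ P) (S' : Set X') (C : X'.IdealSheafData) (τ : X'' ⟶ X'),
      Ch X' σ' S' → IsBlowup τ C → Scheme.IsRegular C.subscheme → Flat (C.subschemeι ≫ σ' ≫ q) →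
      σ' '' (C.support : Set X') ⊆ {x : P | ¬ IsGenericPoint x Y} →
      (C.support : Set X') ∩ (σ' ≫ q) ⁻¹' {closedPoint O} ⊆ S' →
      Ch X'' (τ ≫ σ') (closure (τ ⁻¹' (S' \ (C.support : Set X')))))
    {F₁ F₂ : Scheme.{0}} (W : Set F₁) (G₁ G₂ : Scheme.{0}) (β : G₁ ⟶ F₂) (T Z Kd : Set G₁) (b : Bool)
    (y : ↥(vanishingIdeal (⟨closure Z, isClosed_closure⟩ : Closeds G₁)).subscheme) (υ₁ : G₂ ⟶ G₁)
    (hy : IsClosed ({((vanishingIdeal (⟨closure Z, isClosed_closure⟩ : Closeds G₁)).subschemeι y : G₁)} : Set G₁))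
    (hInv : TCPlus.InvKC O k θ P q Y Ch W G₁ β T Z Kd b)
    (hyT : ((vanishingIdeal (⟨closure Z, isClosed_closure⟩ : Closeds G₁)).subschemeι y : G₁) ∈ T)
    (hyreg : IsRegularLocalRing ((vanishingIdeal (⟨closure Z, isClosed_closure⟩ : Closeds G₁)).subscheme.presheaf.stalk y))
    (hamb : IsRegularLocalRing (G₁.presheaf.stalk ((vanishingIdeal (⟨closure Z, isClosed_closure⟩ : Closeds G₁)).subschemeι y)))
    (hυ₁ : IsBlowup υ₁ (vanishingIdeal ⟨{((vanishingIdeal (⟨closure Z, isClosed_closure⟩ : Closeds G₁)).subschemeι y : G₁)}, hy⟩)) :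
    TCPlus.InvKC O k θ P q Y Ch W G₂ (υ₁ ≫ β)
      (closure (υ₁ ⁻¹' (T \ {((vanishingIdeal (⟨closure Z, isClosed_closure⟩ : Closeds G₁)).subschemeι y : G₁)})))
      (closure (υ₁ ⁻¹' (Z \ {((vanishingIdeal (⟨closure Z, isClosed_closure⟩ : Closeds G₁)).subschemeι y : G₁)})))
      (closure (υ₁ ⁻¹' (Kd \ {((vanishingIdeal (⟨closure Z, isClosed_closure⟩ : Closeds G₁)).subschemeι y : G₁)}))) b := by
  classical
  -- the package transport (res-D-pv-029's T-PKG-TRANSPORT-SCHEME `centredPackage_strictTransform`, p541005)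
  have hpkg : ∀ ⦃X X₂ : Scheme.{0}⦄ [IsIntegral X] [IsLocallyNoetherian X] [IsLocallyNoetherian X₂] (σ : X ⟶ P)
      [IsSeparated (σ ≫ q)], Scheme.IsRegular X → ∀ (s : Spec (.of O) ⟶ X), s ≫ σ ≫ q = 𝟙 _ → ∀ (τ : X₂ ⟶ X), IsBlowup τ s.ker →
      ∀ (𝓢 K : X.IdealSheafData) (p' : X), p' ∉ (s.ker.support : Set X) → ∀ (p'₂ : X₂), τ p'₂ = p' →
      TCPlus.CentredPackage O P q X σ 𝓢 K p' →
      TCPlus.CentredPackage O P q X₂ (τ ≫ σ) (strictTransformIdeal τ s.ker 𝓢) (strictTransformIdeal τ s.ker K) p'₂ :=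
    fun X X₂ _ _ _ σ _ _ s _ τ hτ 𝓢 K p' hp' p'₂ hp'₂ h => centredPackage_strictTransform O P q σ s τ hτ 𝓢 K p' hp' p'₂ hp'₂ h
  obtain ⟨hG₁int, hTcl, hTirr, hTZ, hmem, hsing⟩ := hInv
  haveI := hG₁int
  -- notation-free abbreviations of the point
  have hyZ : ((vanishingIdeal (⟨closure Z, isClosed_closure⟩ : Closeds G₁)).subschemeι y : G₁) ∈ closure Z := by
    have h1 : ((vanishingIdeal (⟨closure Z, isClosed_closure⟩ : Closeds G₁)).subschemeι y : G₁) ∈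
        Set.range (vanishingIdeal (⟨closure Z, isClosed_closure⟩ : Closeds G₁)).subschemeι := ⟨y, rfl⟩
    rw [Scheme.IdealSheafData.range_subschemeι, Scheme.IdealSheafData.coe_support_vanishingIdeal] at h1
    exact h1
  have hyreg' := isRegularLocalRing_quotient_stalkIdeal_of_subschemePoint _ y hyreg
  -- the `∅`-member
  obtain ⟨hG₂int, hirr₂, hT₂Z₂, hmem₂⟩ := memberKC_strictTransform_of_regularPoint O k θ hθ P q Y hY hYirr hYcl hPnoeth hPreg Ch hChain
    hStep hpkg G₁ T Z Kd ∅ hmem hTirr _ hy hyZ hyT hTZ (Set.notMem_empty _) hyreg' hamb G₂ υ₁ hυ₁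
  rw [Set.preimage_empty] at hmem₂
  refine ⟨hG₂int, isClosed_closure, hirr₂, hT₂Z₂, hmem₂, fun hb y₂ hy₂cl hy₂sing => ?_⟩
  -- while `b = false`: the `{y₂}`-members at the non-regular points of the new curve
  haveI : IsClosedImmersion (Spec.map (CommRingCat.ofHom θ)) := IsClosedImmersion.spec_of_surjective _ hθ
  haveI : IsLocallyNoetherian G₁ := by
    obtain ⟨X, σ, S, jG, tG, 𝓢, K, -, -, hXnoeth, -, -, hsq, -⟩ := hmem
    haveI := hXnoeth
    haveI : IsClosedImmersion jG := MorphismProperty.IsStableUnderBaseChange.of_isPullback hsq.flip inferInstance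
    exact LocallyOfFiniteType.isLocallyNoetherian jG
  haveI : IsProper υ₁ := hυ₁.isProper
  haveI : IsLocallyNoetherian G₂ := LocallyOfFiniteType.isLocallyNoetherian υ₁
  -- the two spellings of the new reduced curve
  have e : (vanishingIdeal (⟨closure (closure (υ₁ ⁻¹' (Z \
        {((vanishingIdeal (⟨closure Z, isClosed_closure⟩ : Closeds G₁)).subschemeι y : G₁)}))), isClosed_closure⟩ : Closeds G₂) :
        G₂.IdealSheafData) =
      vanishingIdeal ⟨closure (υ₁ ⁻¹' (closure Z \
        {((vanishingIdeal (⟨closure Z, isClosed_closure⟩ : Closeds G₁)).subschemeι y : G₁)})), isClosed_closure⟩ := by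
    congr 1
    apply Closeds.ext
    change closure (closure _) = closure _
    rw [closure_closure, closure_preimage_closure_diff_singleton hy hυ₁ Z]
  obtain ⟨y₂', hy₂', hy₂'reg⟩ := exists_subschemePoint_of_eq e y₂
  have h₂' := fun h => hy₂sing (hy₂'reg.mp h)
  -- the non-regular point descends to a non-regular `y₁ ≠ y`
  obtain ⟨y₁, hunder, hne, hy₁sing⟩ := singular_point_descends (T := closure Z) (hT := isClosed_closure) hυ₁ hyreg y₂' h₂'
  rw [hy₂'] at hunder
  have hy₁cl : IsClosed ({((vanishingIdeal (⟨closure Z, isClosed_closure⟩ : Closeds G₁)).subschemeι y₁ : G₁)} : Set G₁) := by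
    rw [← hunder, ← Set.image_singleton]
    exact υ₁.isClosedMap _ hy₂cl
  -- the old `{y₁}`-member steps by (A) with `excl = {y₁}`
  have hmem₁ := hsing hb y₁ hy₁cl hy₁sing
  have hyexcl : ((vanishingIdeal (⟨closure Z, isClosed_closure⟩ : Closeds G₁)).subschemeι y : G₁) ∉
      ({((vanishingIdeal (⟨closure Z, isClosed_closure⟩ : Closeds G₁)).subschemeι y₁ : G₁)} : Set G₁) := by
    intro h
    exact hne ((vanishingIdeal (⟨closure Z, isClosed_closure⟩ : Closeds G₁)).subschemeι.isClosedEmbedding.injective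
      (Set.mem_singleton_iff.mp h)).symm
  obtain ⟨-, -, -, hmemA⟩ := memberKC_strictTransform_of_regularPoint O k θ hθ P q Y hY hYirr hYcl hPnoeth hPreg Ch hChain hStep
    hpkg G₁ T Z Kd _ hmem₁ hTirr _ hy hyZ hyT hTZ hyexcl hyreg' hamb G₂ υ₁ hυ₁
  -- `υ₁⁻¹{y₁} = {y₂}`: the blow-up is injective off its centre
  have hnot : ((vanishingIdeal (⟨closure Z, isClosed_closure⟩ : Closeds G₁)).subschemeι y₁ : G₁) ∉
      ((vanishingIdeal (⟨{((vanishingIdeal (⟨closure Z, isClosed_closure⟩ : Closeds G₁)).subschemeι y : G₁)}, hy⟩ :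
        Closeds G₁)).support : Set G₁) := by
    rw [Scheme.IdealSheafData.coe_support_vanishingIdeal]
    exact fun h => hyexcl (by rw [Set.mem_singleton_iff.mp h]; exact Set.mem_singleton _)
  have hset : υ₁ ⁻¹' ({((vanishingIdeal (⟨closure Z, isClosed_closure⟩ : Closeds G₁)).subschemeι y₁ : G₁)} : Set G₁) =
      {((vanishingIdeal (⟨closure (closure (υ₁ ⁻¹' (Z \
        {((vanishingIdeal (⟨closure Z, isClosed_closure⟩ : Closeds G₁)).subschemeι y : G₁)}))), isClosed_closure⟩ :
        Closeds G₂)).subschemeι y₂ : G₂)} := by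
    obtain ⟨z₀, -, huniq⟩ := existsUnique_preimage υ₁ hυ₁.isIso_compl hnot
    ext z
    simp only [Set.mem_preimage, Set.mem_singleton_iff]
    constructor
    · intro hz
      rw [huniq z hz, ← huniq _ hunder]
    · rintro rfl
      exact hunder
  rw [hset] at hmemA
  exact hmemA

end Summit.ResolutionOfSingularities.ResolutionOfSingularities.Cruxes.EquisingularLiftNat.Sections

end
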